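import Mathlib.Analysis.Fourier.AddCircle
import Literature.Analysis.Fourier.ChebyshevDerivativeBounds
import Summits.QuantumFields.YangMills.Theorems.BalabanUVNodesN19LipschitzChebyshevCoefficients

/-!
# N19 (NE7, s3 ALTERNATIVE CURRENCY) — The Chebyshev-moment currency: a LINEAR price for every Lipschitz observable

Module 98 of the `dag-n19-e` lineage; the POSITIVE counterpart of module 96 (CURRENCY-MAP v3 item (w′)).

Module 96: under uniform closeness of the MONOMIAL moments a fixed C¹ observable need not converge
absolutely.  Here: under uniform closeness of the CHEBYSHEV moments it always does, with a linear price.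
★★ `abs_integral_sub_le_of_chebyshev`: for probability laws `μ, ν` on `[−1,1]` and `G` `K`-Lipschitz on
`[−1,1]`,
  `|∫G dμ − ∫G dν| ≤ (πK∕√3) · sup_{l≥1} |∫T_l dμ − ∫T_l dν|`,
hence (★★ `summable_abs_increments_of_chebyshev_close`) along EVERY sequence of laws whose Chebyshev
moments are `r_K`-close step to step with `Σ r_K < ∞`, EVERY Lipschitz observable converges absolutely,
`Σ_K |∫G dΛ_{K+1} − ∫G dΛ_K| ≤ (πK∕√3)Σ_K r_K`.  So the failure of module 96 is exactly the
monomial → Chebyshev coefficient loss of module 90 (`|∫T_j dη| ≤ 3^j r` from `r`-close monomial moments).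

MECHANISM: §1 the Chebyshev∕cosine series of a Lipschitz `G` converges to `G` on `[−1,1]`
(★ `hasSum_chebyshev`): `G∘cos` lifted to the circle `ℝ∕2πℤ` (Mathlib `AddCircle.liftIco`), its
Fourier coefficients are the real, even numbers `(1∕π)∫_0^π G(cos φ)cos(nφ)dφ` (the sine parts vanish
and `[π,2π]` mirrors `[0,π]`), absolutely summable by module 97, so Mathlib's
`has_pointwise_sum_fourier_series_of_summable` applies; fold `n ↔ −n` and take real parts.  §2 dominated
convergence for series against a probability law on `[−1,1]` (`|T_l| ≤ 1` there: the tree's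
`Literature.Analysis.Fourier.abs_eval_T_le_one`) and `Σ_{l≥1}|a_l| ≤ πK∕√3` (module 97).

HONEST FRAMING: [folklore] Fourier analysis over Mathlib and module 97 BY NAME; TOY laws; no consumer in
the DAG today; nothing of Bałaban's is instantiated; NE7 is NOT PRINTED and NOT proved here; N19 is NOT
discharged; count-neutral.  One finite 𝕋⁴ programme at fixed ε; nothing continuum ∕ OS ∕ mass-gap ∕ Clay.
-/

open Real MeasureTheory Polynomial.Chebyshev

namespace Summit.QuantumFields.YangMills.Theorems.BalabanUVNodesN19ChebyshevCurrencyLinearPrice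

open BalabanUVNodesN19LipschitzChebyshevCoefficients

/-! ## §1 The Chebyshev series of a Lipschitz observable converges [folklore] -/

/-- The sine parts vanish: `∫_0^{2π} G(cos x)sin(nx)dx = 0` (reflection `x ↦ 2π − x`). [folklore] -/
theorem integral_compCos_mul_sin_eq_zero {G : ℝ → ℝ} (n : ℤ) :
    ∫ x in (0 : ℝ)..2 * π, G (Real.cos x) * Real.sin (n * x) = 0 := by
  have h := intervalIntegral.integral_comp_sub_left (fun x => G (Real.cos x) * Real.sin (n * x)) (2 * π)
    (a := 0) (b := 2 * π)
  simp only [sub_self, sub_zero] at h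
  have e : ∀ x : ℝ, G (Real.cos (2 * π - x)) * Real.sin (n * (2 * π - x)) = -(G (Real.cos x) * Real.sin (n * x)) := by
    intro x
    rw [Real.cos_two_pi_sub, mul_sub, Real.sin_int_mul_two_pi_sub]; ring
  simp_rw [e, intervalIntegral.integral_neg] at h
  linarith

/-- `[π,2π]` mirrors `[0,π]`: `∫_0^{2π} G(cos x)cos(nx)dx = 2∫_0^π G(cos x)cos(nx)dx`. [folklore] -/
theorem integral_compCos_mul_cos_two_pi {G : ℝ → ℝ} (hG : Continuous G) (n : ℤ) :
    ∫ x in (0 : ℝ)..2 * π, G (Real.cos x) * Real.cos (n * x) = 2 * ∫ x in (0 : ℝ)..π, G (Real.cos x) * Real.cos (n * x) := by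
  have hc : Continuous fun x : ℝ => G (Real.cos x) * Real.cos (n * x) :=
    (hG.comp Real.continuous_cos).mul (Real.continuous_cos.comp (continuous_const.mul continuous_id))
  rw [← intervalIntegral.integral_add_adjacent_intervals (hc.intervalIntegrable 0 π) (hc.intervalIntegrable π (2 * π))]
  have h := intervalIntegral.integral_comp_sub_left (fun x => G (Real.cos x) * Real.cos (n * x)) (2 * π)
    (a := π) (b := 2 * π)
  have e : ∀ x : ℝ, G (Real.cos (2 * π - x)) * Real.cos (n * (2 * π - x)) = G (Real.cos x) * Real.cos (n * x) := by
    intro x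
    rw [Real.cos_two_pi_sub, mul_sub, Real.cos_int_mul_two_pi_sub]
  simp_rw [e] at h
  rw [show 2 * π - 2 * π = (0 : ℝ) by ring, show 2 * π - π = π by ring] at h
  rw [h]; ring

/-- ★ **THE COSINE SERIES OF A LIPSCHITZ `G∘cos` CONVERGES**: for `G` continuous and `K`-Lipschitz on
`[−1,1]` and `θ ∈ [0, 2π)`,
`G(cos θ) = (1∕π)∫_0^π G∘cos + Σ_{m≥0} (2∕π)(∫_0^π G(cos φ)cos((m+1)φ)dφ)·cos((m+1)θ)`. [folklore] -/
theorem hasSum_cosSeries {G : ℝ → ℝ} {K : ℝ} (hG : Continuous G)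
    (hK : ∀ x y : ℝ, x ∈ Set.Icc (-1 : ℝ) 1 → y ∈ Set.Icc (-1 : ℝ) 1 → |G x - G y| ≤ K * |x - y|)
    {θ : ℝ} (hθ : θ ∈ Set.Ico 0 (2 * π)) :
    HasSum (fun m : ℕ => (2 / π * ∫ φ in (0 : ℝ)..π, G (Real.cos φ) * Real.cos (((m : ℝ) + 1) * φ)) *
        Real.cos (((m : ℝ) + 1) * θ))
      (G (Real.cos θ) - 1 / π * ∫ φ in (0 : ℝ)..π, G (Real.cos φ)) := by
  haveI : Fact (0 < 2 * π) := ⟨by positivity⟩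
  -- `G∘cos` on the circle `ℝ ∕ 2πℤ`
  set fR : ℝ → ℂ := fun x => ((G (Real.cos x) : ℝ) : ℂ) with hfR
  have hfRc : Continuous fR := Complex.continuous_ofReal.comp (hG.comp Real.continuous_cos)
  let FC : C(AddCircle (2 * π), ℂ) := ⟨AddCircle.liftIco (2 * π) 0 fR,
    AddCircle.liftIco_continuous (by simp [hfR]) hfRc.continuousOn⟩
  have hFapply : ∀ x : ℝ, x ∈ Set.Ico 0 (2 * π) → FC (x : AddCircle (2 * π)) = fR x := by
    intro x hx
    show AddCircle.liftIco (2 * π) 0 fR x = fR x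
    exact AddCircle.liftIco_coe_apply (by rwa [zero_add])
  -- the coefficients: real, even in `n`
  set c : ℤ → ℝ := fun n => 1 / π * ∫ φ in (0 : ℝ)..π, G (Real.cos φ) * Real.cos (n * φ) with hc
  have hc_neg : ∀ n : ℤ, c (-n) = c n := fun n => by
    simp only [hc, Int.cast_neg, neg_mul, Real.cos_neg]
  have hcoeff : ∀ n : ℤ, fourierCoeff FC n = ((c n : ℝ) : ℂ) := by
    intro n
    rw [fourierCoeff_eq_intervalIntegral FC n 0, zero_add]
    have hI : ∫ x in (0 : ℝ)..2 * π, (fourier (-n) (x : AddCircle (2 * π))) • FC x =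
        ∫ x in (0 : ℝ)..2 * π, (((G (Real.cos x) * Real.cos (n * x) : ℝ) : ℂ) -
          Complex.I * ((G (Real.cos x) * Real.sin (n * x) : ℝ) : ℂ)) := by
      refine intervalIntegral.integral_congr_Ioo_of_le (by positivity) fun x hx => ?_
      rw [fourier_coe_apply, hFapply x (Set.Ioo_subset_Ico_self hx), smul_eq_mul]
      simp only [hfR]
      have he : Complex.exp (2 * π * Complex.I * ((-n : ℤ) : ℂ) * x / ((2 * π : ℝ) : ℂ)) =
          Complex.exp ((-(n * x : ℝ) : ℂ) * Complex.I) := by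
        congr 1; push_cast; field_simp
      rw [he, Complex.exp_mul_I, Complex.cos_neg, Complex.sin_neg, ← Complex.ofReal_cos, ← Complex.ofReal_sin]
      push_cast; ring
    rw [hI, intervalIntegral.integral_sub, intervalIntegral.integral_const_mul, intervalIntegral.integral_ofReal,
      intervalIntegral.integral_ofReal, integral_compCos_mul_sin_eq_zero, integral_compCos_mul_cos_two_pi hG]
    · simp only [hc, Complex.ofReal_zero, mul_zero, sub_zero, Complex.real_smul]
      push_cast; field_simp
    · exact (Complex.continuous_ofReal.comp ((hG.comp Real.continuous_cos).mul
        (Real.continuous_cos.comp (continuous_const.mul continuous_id)))).intervalIntegrable _ _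
    · exact (continuous_const.mul (Complex.continuous_ofReal.comp ((hG.comp Real.continuous_cos).mul
        (Real.continuous_sin.comp (continuous_const.mul continuous_id))))).intervalIntegrable _ _
  -- summability of the coefficients (module 97)
  have hsabs : Summable (fun m : ℕ => |∫ θ in (0 : ℝ)..π, G (Real.cos θ) * Real.cos (((m : ℝ) + 1) * θ)|) :=
    (summable_abs_cosCoeff hK).1
  have hcnat : ∀ m : ℕ, c ((m : ℤ) + 1) = 1 / π * ∫ θ in (0 : ℝ)..π, G (Real.cos θ) * Real.cos (((m : ℝ) + 1) * θ) := by
    intro m; simp only [hc]; push_cast; rfl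
  have hsum : Summable (fourierCoeff FC) := by
    refine Summable.of_norm ?_
    have e : (fun n : ℤ => ‖fourierCoeff FC n‖) = fun n => |c n| := by
      funext n; rw [hcoeff, Complex.norm_real, Real.norm_eq_abs]
    rw [e]
    refine Summable.of_add_one_of_neg_add_one ?_ ?_
    · have : (fun m : ℕ => |c ((m : ℤ) + 1)|) = fun m : ℕ => 1 / π * |∫ θ in (0 : ℝ)..π, G (Real.cos θ) * Real.cos (((m : ℝ) + 1) * θ)| := by
        funext m; rw [hcnat, abs_mul, abs_of_pos (by positivity)]
      rw [this]; exact hsabs.mul_left _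
    · have : (fun m : ℕ => |c (-((m : ℤ) + 1))|) = fun m : ℕ => 1 / π * |∫ θ in (0 : ℝ)..π, G (Real.cos θ) * Real.cos (((m : ℝ) + 1) * θ)| := by
        funext m; rw [hc_neg, hcnat, abs_mul, abs_of_pos (by positivity)]
      rw [this]; exact hsabs.mul_left _
  -- the Fourier series at `θ`
  have hpt := has_pointwise_sum_fourier_series_of_summable hsum (θ : AddCircle (2 * π))
  have hfun : (fun n : ℤ => fourierCoeff FC n • fourier n (θ : AddCircle (2 * π))) =
      fun n : ℤ => ((c n : ℝ) : ℂ) * Complex.exp (((n * θ : ℝ) : ℂ) * Complex.I) := by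
    funext n
    rw [hcoeff, fourier_coe_apply, smul_eq_mul]
    congr 1; congr 1; push_cast; field_simp
  rw [hfun, hFapply θ hθ] at hpt
  -- fold `n ↔ −n`
  have hfold := hpt.nat_add_neg
  have hterm : ∀ m : ℕ, ((c m : ℝ) : ℂ) * Complex.exp ((((m : ℤ) * θ : ℝ) : ℂ) * Complex.I) +
      ((c (-(m : ℤ)) : ℝ) : ℂ) * Complex.exp ((((-(m : ℤ) : ℤ) * θ : ℝ) : ℂ) * Complex.I) =
      ((2 * c m * Real.cos (m * θ) : ℝ) : ℂ) := by
    intro m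
    rw [hc_neg]
    have ex : ((((-(m : ℤ) : ℤ)) * θ : ℝ) : ℂ) = -((((m : ℤ) * θ : ℝ) : ℂ)) := by push_cast; ring
    rw [ex, ← mul_add, ← Complex.two_cos, ← Complex.ofReal_cos]
    push_cast; ring
  simp only [Int.cast_natCast] at hterm hfold
  simp_rw [hterm] at hfold
  have h0 : ((c 0 : ℝ) : ℂ) * Complex.exp ((((0 : ℤ) : ℝ) * θ : ℝ) * Complex.I) = ((c 0 : ℝ) : ℂ) := by simp
  rw [h0, ← Complex.ofReal_add, Complex.hasSum_ofReal] at hfold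
  -- drop the `m = 0` term
  have hshift := (hasSum_nat_add_iff' (f := fun m : ℕ => 2 * c m * Real.cos (m * θ)) 1).2 hfold
  simp only [Finset.sum_range_one, Nat.cast_zero, zero_mul, Real.cos_zero, mul_one] at hshift
  have hc0 : c 0 = 1 / π * ∫ φ in (0 : ℝ)..π, G (Real.cos φ) := by simp [hc]
  have e2 : G (Real.cos θ) + c 0 - 2 * c 0 = G (Real.cos θ) - 1 / π * ∫ φ in (0 : ℝ)..π, G (Real.cos φ) := by
    rw [hc0]; ring
  rw [e2] at hshift
  refine (hshift.congr_fun ?_ : _)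
  intro m
  have : c ((m + 1 : ℕ) : ℤ) = 1 / π * ∫ φ in (0 : ℝ)..π, G (Real.cos φ) * Real.cos (((m : ℝ) + 1) * φ) := by
    simp only [hc]; push_cast; rfl
  simp only [this]
  push_cast; ring

/-- ★ **THE CHEBYSHEV SERIES OF A LIPSCHITZ OBSERVABLE CONVERGES ON `[−1,1]`:**
`G(x) = (1∕π)∫_0^π G∘cos + Σ_{m≥0} (2∕π)(∫_0^π G(cos φ)cos((m+1)φ)dφ)·T_{m+1}(x)`. [folklore] -/
theorem hasSum_chebyshev {G : ℝ → ℝ} {K : ℝ} (hG : Continuous G)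
    (hK : ∀ x y : ℝ, x ∈ Set.Icc (-1 : ℝ) 1 → y ∈ Set.Icc (-1 : ℝ) 1 → |G x - G y| ≤ K * |x - y|)
    {x : ℝ} (hx : x ∈ Set.Icc (-1 : ℝ) 1) :
    HasSum (fun m : ℕ => (2 / π * ∫ φ in (0 : ℝ)..π, G (Real.cos φ) * Real.cos (((m : ℝ) + 1) * φ)) *
        (T ℝ (m + 1)).eval x)
      (G x - 1 / π * ∫ φ in (0 : ℝ)..π, G (Real.cos φ)) := by
  have hθ : Real.arccos x ∈ Set.Ico 0 (2 * π) :=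
    ⟨Real.arccos_nonneg x, (Real.arccos_le_pi x).trans_lt (by linarith [Real.pi_pos])⟩
  have h := hasSum_cosSeries hG hK hθ
  rw [Real.cos_arccos hx.1 hx.2] at h
  refine h.congr_fun fun m => ?_
  rw [← Real.cos_arccos hx.1 hx.2, T_real_cos]
  push_cast
  rw [Real.cos_arccos hx.1 hx.2]

/-! ## §2 The linear price in the Chebyshev-moment currency [folklore] -/

/-- ★ **THE CHEBYSHEV SERIES INTEGRATES TERMWISE** against a probability law on `[−1,1]`:
`∫G dμ = (1∕π)∫_0^π G∘cos + Σ_m (2∕π)(∫_0^π G(cos φ)cos((m+1)φ)dφ)·∫T_{m+1} dμ`. [folklore] -/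
theorem hasSum_integral_chebyshev {G : ℝ → ℝ} {K : ℝ} (hG : Continuous G)
    (hK : ∀ x y : ℝ, x ∈ Set.Icc (-1 : ℝ) 1 → y ∈ Set.Icc (-1 : ℝ) 1 → |G x - G y| ≤ K * |x - y|)
    (μ : Measure ℝ) [IsProbabilityMeasure μ] (hμ : μ (Set.Icc (-1 : ℝ) 1)ᶜ = 0) :
    HasSum (fun m : ℕ => (2 / π * ∫ φ in (0 : ℝ)..π, G (Real.cos φ) * Real.cos (((m : ℝ) + 1) * φ)) *
        ∫ x, (T ℝ (m + 1)).eval x ∂μ)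
      (∫ x, G x ∂μ - 1 / π * ∫ φ in (0 : ℝ)..π, G (Real.cos φ)) := by
  have hae : ∀ᵐ x ∂μ, x ∈ Set.Icc (-1 : ℝ) 1 := mem_ae_iff.2 hμ
  set a : ℕ → ℝ := fun m => 2 / π * ∫ φ in (0 : ℝ)..π, G (Real.cos φ) * Real.cos (((m : ℝ) + 1) * φ) with ha
  have hsum : Summable fun m => |a m| := by
    have := (summable_abs_cosCoeff hK).1.mul_left (2 / π)
    refine this.congr fun m => ?_
    simp only [ha]
    rw [abs_mul, abs_of_pos (by positivity : (0 : ℝ) < 2 / π)]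
  -- bounded on the support: `|G x| ≤ |G 0| + K` on `[−1,1]`
  have hGb : ∀ x ∈ Set.Icc (-1 : ℝ) 1, |G x| ≤ |G 0| + K := by
    intro x hx
    have h1 := hK x 0 hx ⟨by norm_num, by norm_num⟩
    rw [sub_zero] at h1
    have h2 : |x| ≤ 1 := abs_le.2 ⟨hx.1, hx.2⟩
    have hK0 := lipConst_nonneg hK
    calc |G x| = |(G x - G 0) + G 0| := by ring_nf
      _ ≤ |G x - G 0| + |G 0| := abs_add_le _ _
      _ ≤ K * |x| + |G 0| := by linarith
      _ ≤ |G 0| + K := by nlinarith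
  have hGi : Integrable G μ :=
    Integrable.of_bound hG.aestronglyMeasurable (|G 0| + K)
      (hae.mono fun x hx => by rw [Real.norm_eq_abs]; exact hGb x hx)
  have h := hasSum_integral_of_dominated_convergence (μ := μ) (fun m _ => |a m|)
    (F := fun m x => a m * (T ℝ (m + 1)).eval x) (f := fun x => G x - 1 / π * ∫ φ in (0 : ℝ)..π, G (Real.cos φ))
    (fun m => ((continuous_const.mul (Polynomial.continuous _))).aestronglyMeasurable)
    (fun m => hae.mono fun x hx => by
      rw [norm_mul, Real.norm_eq_abs, Real.norm_eq_abs]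
      exact mul_le_of_le_one_right (abs_nonneg _) (Literature.Analysis.Fourier.abs_eval_T_le_one _ hx))
    (Filter.Eventually.of_forall fun _ => hsum) (integrable_const _)
    (hae.mono fun x hx => hasSum_chebyshev hG hK hx)
  rw [integral_sub hGi (integrable_const _), integral_const, smul_eq_mul, probReal_univ, one_mul] at h
  refine h.congr_fun fun m => ?_
  exact (integral_const_mul _ _).symm

/-- ★★ **THE LINEAR PRICE OF A LIPSCHITZ OBSERVABLE IN THE CHEBYSHEV-MOMENT CURRENCY.**  For probability
laws `μ, ν` on `[−1,1]` whose Chebyshev moments are `r`-close, `|∫T_l dμ − ∫T_l dν| ≤ r` for all `l ≥ 1`,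
and `G` continuous and `K`-Lipschitz on `[−1,1]`: `|∫G dμ − ∫G dν| ≤ (πK∕√3)·r`.  Compare the SHARP
per-step law price `48(K+G)∕(1 + log r⁻¹)` of the MONOMIAL-moment currency (modules 78∕79): the two
«uniform moment» currencies differ by the exponential coefficient loss `x^j ↔ T_j`. [folklore] -/
theorem abs_integral_sub_le_of_chebyshev {G : ℝ → ℝ} {K : ℝ} (hG : Continuous G)
    (hK : ∀ x y : ℝ, x ∈ Set.Icc (-1 : ℝ) 1 → y ∈ Set.Icc (-1 : ℝ) 1 → |G x - G y| ≤ K * |x - y|)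
    (μ ν : Measure ℝ) [IsProbabilityMeasure μ] [IsProbabilityMeasure ν]
    (hμ : μ (Set.Icc (-1 : ℝ) 1)ᶜ = 0) (hν : ν (Set.Icc (-1 : ℝ) 1)ᶜ = 0) {r : ℝ}
    (hr : ∀ l : ℕ, 1 ≤ l → |∫ x, (T ℝ l).eval x ∂μ - ∫ x, (T ℝ l).eval x ∂ν| ≤ r) :
    |∫ x, G x ∂μ - ∫ x, G x ∂ν| ≤ π * K / Real.sqrt 3 * r := by
  have h1 := hasSum_integral_chebyshev hG hK μ hμ
  have h2 := hasSum_integral_chebyshev hG hK ν hν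
  have h := h1.sub h2
  have e : (∫ x, G x ∂μ - 1 / π * ∫ φ in (0 : ℝ)..π, G (Real.cos φ)) -
      (∫ x, G x ∂ν - 1 / π * ∫ φ in (0 : ℝ)..π, G (Real.cos φ)) = ∫ x, G x ∂μ - ∫ x, G x ∂ν := by ring
  rw [e] at h
  have hr0 : 0 ≤ r := (abs_nonneg _).trans (hr 1 le_rfl)
  set I : ℕ → ℝ := fun m => ∫ φ in (0 : ℝ)..π, G (Real.cos φ) * Real.cos (((m : ℝ) + 1) * φ) with hI
  have hsabs := summable_abs_cosCoeff hK
  -- termwise bound `|a_{m+1}(∫T dμ − ∫T dν)| ≤ (2∕π)|I_m|·r`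
  have hterm : ∀ m : ℕ, ‖(2 / π * I m) * ∫ x, (T ℝ (m + 1)).eval x ∂μ - (2 / π * I m) * ∫ x, (T ℝ (m + 1)).eval x ∂ν‖ ≤
      2 / π * r * |I m| := by
    intro m
    rw [← mul_sub, Real.norm_eq_abs, abs_mul, abs_mul, abs_of_pos (by positivity : (0 : ℝ) < 2 / π)]
    have := hr (m + 1) (by omega)
    push_cast at this
    calc 2 / π * |I m| * |∫ x, (T ℝ (m + 1)).eval x ∂μ - ∫ x, (T ℝ (m + 1)).eval x ∂ν|
        ≤ 2 / π * |I m| * r := mul_le_mul_of_nonneg_left this (by positivity)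
      _ = 2 / π * r * |I m| := by ring
  have hbsum : Summable fun m : ℕ => 2 / π * r * |I m| := hsabs.1.mul_left _
  calc |∫ x, G x ∂μ - ∫ x, G x ∂ν|
      = ‖∑' m : ℕ, ((2 / π * I m) * ∫ x, (T ℝ (m + 1)).eval x ∂μ - (2 / π * I m) * ∫ x, (T ℝ (m + 1)).eval x ∂ν)‖ := by
        rw [h.tsum_eq, Real.norm_eq_abs]
    _ ≤ ∑' m : ℕ, 2 / π * r * |I m| := tsum_of_norm_bounded hbsum.hasSum hterm
    _ = 2 / π * r * ∑' m : ℕ, |I m| := tsum_mul_left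
    _ ≤ 2 / π * r * (π ^ 2 * K / (2 * Real.sqrt 3)) := mul_le_mul_of_nonneg_left hsabs.2 (by positivity)
    _ = π * K / Real.sqrt 3 * r := by field_simp

/-- ★★ **EVERY SEQUENCE, EVERY LIPSCHITZ OBSERVABLE — in the Chebyshev currency.**  If probability laws
`Λ_K` on `[−1,1]` have Chebyshev moments `r_K`-close step to step, `|∫T_l dΛ_{K+1} − ∫T_l dΛ_K| ≤ r_K`
(`l ≥ 1`), with `Σ_K r_K < ∞`, then for every continuous `K`-Lipschitz `G` the expectation increments
are absolutely summable, `Σ_K |∫G dΛ_{K+1} − ∫G dΛ_K| ≤ (πK∕√3)·Σ_K r_K`.  (Contrast module 96: with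
MONOMIAL moments this fails for a C¹ observable.) [folklore] -/
theorem summable_abs_increments_of_chebyshev_close {G : ℝ → ℝ} {K : ℝ} (hG : Continuous G)
    (hK : ∀ x y : ℝ, x ∈ Set.Icc (-1 : ℝ) 1 → y ∈ Set.Icc (-1 : ℝ) 1 → |G x - G y| ≤ K * |x - y|)
    (Λ : ℕ → Measure ℝ) (hP : ∀ n, IsProbabilityMeasure (Λ n)) (hΛ : ∀ n, Λ n (Set.Icc (-1 : ℝ) 1)ᶜ = 0)
    {r : ℕ → ℝ} (hr : Summable r)
    (hclose : ∀ (n l : ℕ), 1 ≤ l → |∫ x, (T ℝ l).eval x ∂Λ (n + 1) - ∫ x, (T ℝ l).eval x ∂Λ n| ≤ r n) :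
    Summable (fun n => |∫ x, G x ∂Λ (n + 1) - ∫ x, G x ∂Λ n|) ∧
      ∑' n, |∫ x, G x ∂Λ (n + 1) - ∫ x, G x ∂Λ n| ≤ π * K / Real.sqrt 3 * ∑' n, r n := by
  have hstep : ∀ n, |∫ x, G x ∂Λ (n + 1) - ∫ x, G x ∂Λ n| ≤ π * K / Real.sqrt 3 * r n := fun n => by
    haveI := hP n; haveI := hP (n + 1)
    exact abs_integral_sub_le_of_chebyshev hG hK (Λ (n + 1)) (Λ n) (hΛ (n + 1)) (hΛ n) (hclose n)
  have hK0 := lipConst_nonneg hK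
  have hs : Summable (fun n => |∫ x, G x ∂Λ (n + 1) - ∫ x, G x ∂Λ n|) :=
    Summable.of_nonneg_of_le (fun n => abs_nonneg _) hstep (hr.mul_left _)
  refine ⟨hs, ?_⟩
  calc ∑' n, |∫ x, G x ∂Λ (n + 1) - ∫ x, G x ∂Λ n| ≤ ∑' n, π * K / Real.sqrt 3 * r n :=
        hs.tsum_le_tsum hstep (hr.mul_left _)
    _ = π * K / Real.sqrt 3 * ∑' n, r n := tsum_mul_left

end Summit.QuantumFields.YangMills.Theorems.BalabanUVNodesN19ChebyshevCurrencyLinearPrice
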